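import Mathlib.Data.Matrix.Basic
import Mathlib.Data.Real.Basic
import Mathlib.Algebra.Order.BigOperators.Ring.Finset
import Mathlib.Data.Fin.Tuple.Basic
import Mathlib.Data.List.OfFn
import HarnessLib

/-!
# Uniform matrix-product (transducer) contraction certificates: one local LMI ⟹ `(ξᵀ X_k η)² ≤ λ‖ξ‖²‖η‖²` for EVERY length `k`
# (Sahi programme, prover prim-sahi-p2 gen 62)

Support file (`--supports stmt-CriticalPhenomena-4575`, helper).  Standard axioms, no sorries, no definitions.  Memo
`run/shared/lean/prim/prim-sahi/FROM-prim-sahi-p2-gen62-TRANSDUCER.md`.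

Setting.  `B` (bond), `E₁`, `E₂` (step alphabets) finite types; local tensors `T e e' : Matrix B B ℝ`; boundary vectors
`α ω : B → ℝ`.  For words `p : Fin k → E₁`, `p' : Fin k → E₂` the matrix-product operator is
`X_k[p,p'] = α ⬝ᵥ ((List.ofFn fun i => T (p i) (p' i)).prod *ᵥ ω)`.
If a positive form `Q` satisfies the boundary condition `(α ⬝ᵥ c)² ≤ cᵀQc` (i.e. `ααᵀ ⪯ Q`) and the ONE-STEP condition
`∑_{e'} (∑_e T e e' v_e)ᵀ Q (∑_e T e e' v_e) ≤ ∑_e v_eᵀ Q v_e` for all `v : E₁ → B → ℝ`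
(i.e. `∑_{e'} T[·,e']ᵀ Q T[·,e'] ⪯ Q ⊗ I_{E₁}`), then for every `k` and all `ξ, η`:
`(∑_{p,p'} ξ_p X_k[p,p'] η_{p'})² ≤ (ωᵀQω)·‖ξ‖²·‖η‖²` — the operator norm of `X_k` is at most `√(ωᵀQω)` uniformly in `k`.
This is the principle that turns ONE finite semidefinite certificate (a "transducer" over the bad/P1/P2 automata of the
boundary-star cycle, gen 61 §8(1)) into the cycle inequality `bad² ≤ #P1·#P2` for cycles of EVERY length.
* `sum_pi_fin_succ` — `∑_{p : Fin (k+1) → E} F p = ∑_e ∑_{t : Fin k → E} F (Fin.snoc t e)` [folklore].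
* **`transducer_gram_le`** [this work] — the inductive Gram bound `∑_{p'} (∑_p αᵀ X(p,p') c_p)² ≤ ∑_p c_pᵀ Q c_p`.
* **`transducer_bilin_sq_le`** [this work] — the bilinear bound above.
[folklore] (isometric tensor-network / quadratic Lyapunov argument; this elementary finite-sum form is ours).
-/

namespace Summit.CriticalPhenomena.PercolationContinuityZ3.Theorems.ProductFormTransducer

open Matrix

variable {B E₁ E₂ : Type*} [Fintype B] [DecidableEq B] [Fintype E₁] [Fintype E₂]

omit [Fintype B] [DecidableEq B] [Fintype E₁] [Fintype E₂] in
/-- Splitting a sum over words of length `k+1` into the last letter and the prefix. [folklore] -/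
theorem sum_pi_fin_succ {E : Type*} [Fintype E] {M : Type*} [AddCommMonoid M] {k : ℕ}
    (F : (Fin (k + 1) → E) → M) : ∑ p, F p = ∑ e : E, ∑ t : Fin k → E, F (Fin.snoc t e) := by
  rw [← (Fin.snocEquiv fun _ => E).sum_comp, Fintype.sum_prod_type]
  rfl

omit [Fintype E₁] [Fintype E₂] in
/-- The word product for `snoc`-extended words splits off its last factor. [folklore] -/
theorem prod_ofFn_snoc {k : ℕ} (T : E₁ → E₂ → Matrix B B ℝ) (t : Fin k → E₁) (t' : Fin k → E₂) (e : E₁) (e' : E₂) :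
    (List.ofFn fun i => T ((Fin.snoc t e : Fin (k + 1) → E₁) i) ((Fin.snoc t' e' : Fin (k + 1) → E₂) i)).prod
      = (List.ofFn fun i => T (t i) (t' i)).prod * T e e' := by
  rw [List.ofFn_succ']
  simp only [Fin.snoc_castSucc, Fin.snoc_last, List.prod_concat]

/-- **Inductive Gram bound for a uniform matrix-product operator** [this work].  Under the boundary condition `ααᵀ ⪯ Q` and the
one-step condition `∑_{e'} T[·,e']ᵀ Q T[·,e'] ⪯ Q ⊗ I`, for every `k` and every family `c` of right-boundary vectors indexed by
`E₁`-words: `∑_{p'} (∑_p αᵀ Π_i T(p i)(p' i) c_p)² ≤ ∑_p c_pᵀ Q c_p`. -/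
theorem transducer_gram_le (T : E₁ → E₂ → Matrix B B ℝ) (Q : Matrix B B ℝ) (α : B → ℝ)
    (hα : ∀ c : B → ℝ, (α ⬝ᵥ c) ^ 2 ≤ c ⬝ᵥ (Q *ᵥ c))
    (hstep : ∀ v : E₁ → B → ℝ,
      ∑ e', (∑ e, T e e' *ᵥ v e) ⬝ᵥ (Q *ᵥ ∑ e, T e e' *ᵥ v e) ≤ ∑ e, v e ⬝ᵥ (Q *ᵥ v e)) :
    ∀ (k : ℕ) (c : (Fin k → E₁) → B → ℝ),
      ∑ p' : Fin k → E₂, (∑ p : Fin k → E₁, α ⬝ᵥ ((List.ofFn fun i => T (p i) (p' i)).prod *ᵥ c p)) ^ 2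
        ≤ ∑ p : Fin k → E₁, c p ⬝ᵥ (Q *ᵥ c p) := by
  intro k
  induction k with
  | zero =>
    intro c
    rw [Fintype.sum_unique, Fintype.sum_unique, Fintype.sum_unique]
    simp only [List.ofFn_zero, List.prod_nil, Matrix.one_mulVec]
    exact hα _
  | succ k ih =>
    intro c
    -- split the sums over words of length k+1
    rw [sum_pi_fin_succ (fun p : Fin (k + 1) → E₁ => c p ⬝ᵥ (Q *ᵥ c p))]
    rw [sum_pi_fin_succ (fun p' : Fin (k + 1) → E₂ =>
      (∑ p : Fin (k + 1) → E₁, α ⬝ᵥ ((List.ofFn fun i => T (p i) (p' i)).prod *ᵥ c p)) ^ 2)]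
    -- the reduced right-boundary families
    set ct : E₂ → (Fin k → E₁) → B → ℝ := fun e' t => ∑ e, T e e' *ᵥ c (Fin.snoc t e) with hct
    have hinner : ∀ (e' : E₂) (t' : Fin k → E₂),
        (∑ p : Fin (k + 1) → E₁, α ⬝ᵥ ((List.ofFn fun i => T (p i) ((Fin.snoc t' e' : Fin (k + 1) → E₂) i)).prod *ᵥ c p))
          = ∑ t : Fin k → E₁, α ⬝ᵥ ((List.ofFn fun i => T (t i) (t' i)).prod *ᵥ ct e' t) := by
      intro e' t'
      rw [sum_pi_fin_succ (fun p : Fin (k + 1) → E₁ =>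
        α ⬝ᵥ ((List.ofFn fun i => T (p i) ((Fin.snoc t' e' : Fin (k + 1) → E₂) i)).prod *ᵥ c p))]
      rw [Finset.sum_comm]
      refine Finset.sum_congr rfl fun t _ => ?_
      simp only [hct, prod_ofFn_snoc, ← Matrix.mulVec_mulVec]
      rw [Matrix.mulVec_sum, dotProduct_sum]
    calc ∑ e', ∑ t' : Fin k → E₂,
          (∑ p : Fin (k + 1) → E₁, α ⬝ᵥ ((List.ofFn fun i => T (p i) ((Fin.snoc t' e' : Fin (k + 1) → E₂) i)).prod *ᵥ c p)) ^ 2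
        = ∑ e', ∑ t' : Fin k → E₂, (∑ t : Fin k → E₁, α ⬝ᵥ ((List.ofFn fun i => T (t i) (t' i)).prod *ᵥ ct e' t)) ^ 2 := by
          simp only [hinner]
      _ ≤ ∑ e', ∑ t : Fin k → E₁, ct e' t ⬝ᵥ (Q *ᵥ ct e' t) := Finset.sum_le_sum fun e' _ => ih (ct e')
      _ = ∑ t : Fin k → E₁, ∑ e', ct e' t ⬝ᵥ (Q *ᵥ ct e' t) := Finset.sum_comm
      _ ≤ ∑ t : Fin k → E₁, ∑ e, c (Fin.snoc t e) ⬝ᵥ (Q *ᵥ c (Fin.snoc t e)) :=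
          Finset.sum_le_sum fun t _ => hstep (fun e => c (Fin.snoc t e))
      _ = ∑ e, ∑ t : Fin k → E₁, c (Fin.snoc t e) ⬝ᵥ (Q *ᵥ c (Fin.snoc t e)) := Finset.sum_comm

/-- **Uniform bilinear bound for a matrix-product (transducer) operator** [this work].  If `ααᵀ ⪯ Q` and
`∑_{e'} T[·,e']ᵀ Q T[·,e'] ⪯ Q ⊗ I_{E₁}` (both as quadratic-form inequalities), then for EVERY `k` and all real `ξ, η`:
`(∑_{p,p'} ξ_p · αᵀ(Π_i T(p i)(p' i))ω · η_{p'})² ≤ (ωᵀQω) · ∑ ξ² · ∑ η²`.  With `ωᵀQω ≤ 1` the operator `X_k` is a contraction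
for every `k`; combined with `∑ ξ_p² = #P1`, `∑ η_{p'}² = #P2` (configuration monomials) and `ξᵀ X_k η = bad` this is the all-`k`
boundary-star cycle inequality `bad² ≤ #P1·#P2`. -/
theorem transducer_bilin_sq_le (T : E₁ → E₂ → Matrix B B ℝ) (Q : Matrix B B ℝ) (α ω : B → ℝ)
    (hα : ∀ c : B → ℝ, (α ⬝ᵥ c) ^ 2 ≤ c ⬝ᵥ (Q *ᵥ c))
    (hstep : ∀ v : E₁ → B → ℝ,
      ∑ e', (∑ e, T e e' *ᵥ v e) ⬝ᵥ (Q *ᵥ ∑ e, T e e' *ᵥ v e) ≤ ∑ e, v e ⬝ᵥ (Q *ᵥ v e))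
    (k : ℕ) (ξ : (Fin k → E₁) → ℝ) (η : (Fin k → E₂) → ℝ) :
    (∑ p : Fin k → E₁, ∑ p' : Fin k → E₂,
        ξ p * (α ⬝ᵥ ((List.ofFn fun i => T (p i) (p' i)).prod *ᵥ ω)) * η p') ^ 2
      ≤ (ω ⬝ᵥ (Q *ᵥ ω)) * (∑ p, ξ p ^ 2) * (∑ p', η p' ^ 2) := by
  -- Y p' = ∑_p ξ_p X[p,p']
  set Y : (Fin k → E₂) → ℝ := fun p' => ∑ p : Fin k → E₁,
    α ⬝ᵥ ((List.ofFn fun i => T (p i) (p' i)).prod *ᵥ (ξ p • ω)) with hY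
  have hXY : (∑ p : Fin k → E₁, ∑ p' : Fin k → E₂,
        ξ p * (α ⬝ᵥ ((List.ofFn fun i => T (p i) (p' i)).prod *ᵥ ω)) * η p')
      = ∑ p', Y p' * η p' := by
    rw [Finset.sum_comm]
    refine Finset.sum_congr rfl fun p' _ => ?_
    rw [hY, Finset.sum_mul]
    refine Finset.sum_congr rfl fun p _ => ?_
    rw [Matrix.mulVec_smul, dotProduct_smul, smul_eq_mul]
  have hgram := transducer_gram_le T Q α hα hstep k (fun p => ξ p • ω)
  have hq : ∑ p : Fin k → E₁, (ξ p • ω) ⬝ᵥ (Q *ᵥ (ξ p • ω)) = (ω ⬝ᵥ (Q *ᵥ ω)) * ∑ p, ξ p ^ 2 := by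
    rw [Finset.mul_sum]
    refine Finset.sum_congr rfl fun p _ => ?_
    rw [Matrix.mulVec_smul, smul_dotProduct, dotProduct_smul, smul_eq_mul, smul_eq_mul]
    ring
  rw [hq] at hgram
  have hcs := Finset.sum_mul_sq_le_sq_mul_sq Finset.univ Y η
  have hη : 0 ≤ ∑ p', η p' ^ 2 := Finset.sum_nonneg fun _ _ => sq_nonneg _
  rw [hXY]
  calc (∑ p', Y p' * η p') ^ 2 ≤ (∑ p', Y p' ^ 2) * ∑ p', η p' ^ 2 := hcs
    _ ≤ ((ω ⬝ᵥ (Q *ᵥ ω)) * ∑ p, ξ p ^ 2) * ∑ p', η p' ^ 2 :=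
        mul_le_mul_of_nonneg_right hgram hη
    _ = (ω ⬝ᵥ (Q *ᵥ ω)) * (∑ p, ξ p ^ 2) * (∑ p', η p' ^ 2) := by ring

end Summit.CriticalPhenomena.PercolationContinuityZ3.Theorems.ProductFormTransducer
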